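import Mathlib
import Summits.Ventures.HodgeRepro2.T5CyclotomicTwentyOneSextic

/-!
# THE CENSUS OF THE NON-CYCLOTOMIC SEXTIC GALOIS CM FIELD `F = ℚ(ζ₂₁)^{⟨σ₁₃⟩}` BY `p mod 21`

Tier-5 support N2 / N3 / §G-N4.2 (seat p3, gen 81). Files 286–287 (the residue degree of `p ∤ m` in a subfield
`F ⊆ ℚ(ζₘ)` is the order of `p · H_F` in `(ℤ/mℤ)ˣ / H_F`; the sextic CM census reads off that order) applied to
file 288's field `F = ℚ(ζ₂₁)^{⟨σ₁₃⟩}` (sextic Galois CM, NOT cyclotomic, `H_F = ⟨13⟩`):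

* `inertiaDeg_eq`, `ncard_primesOver_mul_orderOf`, **`exists_map_eq_iff`**, `ncard_primesOver_eq_two_iff`: the census
  of `F` at every `p ∤ 21` in terms of `ord(p · ⟨13⟩)`;
* the numerals: `2` and `5` are INERT in `F` (`f = 6`; the place of `F⁺` under them stays prime — `census_two`,
  `census_five`); `29 ≡ 8` and `41 ≡ −1` have `f = 2` (three primes of `F`; every place of `F⁺` above them STAYS PRIME
  in `F` — `census_twentyNine`, `census_fortyOne`); `13`, `43 ≡ 1` and `97 ≡ 13` SPLIT COMPLETELY (`f = 1`, six
  primes; two primes of `F` above every place of `F⁺` — `census_thirteen`, `census_fortyThree`,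
  `census_ninetySeven`), although `97` has residue degree `2` in `ℚ(ζ₂₁)` itself (`inertiaDeg_ninetySeven_cyclotomic`):
  the quotient by `H_F` is not idle.

§8(d): uses an L-value-free non-vanishing device: NO.
-/

open NumberField IsCyclotomicExtension.Rat Ideal IsDedekindDomain IsDedekindDomain.HeightOneSpectrum
open Summit.Ventures.HodgeRepro2.T5CyclotomicSubfieldInertiaDeg
  Summit.Ventures.HodgeRepro2.T5CyclotomicSubfieldSexticCensus
  Summit.Ventures.HodgeRepro2.T5CyclotomicTwentyOneSextic

namespace Summit.Ventures.HodgeRepro2.T5CyclotomicTwentyOneCensus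

section Census

variable (L : Type*) [Field L] [NumberField L] [IsCyclotomicExtension {21} ℚ L]
variable (p : ℕ) [hp : Fact p.Prime] (hpm : p.Coprime 21)
  (P : Ideal (𝓞 (fixedField L))) [hP : P.IsPrime] [hPp : P.LiesOver (span {(p : ℤ)})]

include hpm hP hPp in
/-- **`f(P/p)` in `F` is the order of `p · ⟨13⟩` in `(ℤ/21ℤ)ˣ / ⟨13⟩`** (file 286 on `F`). -/
theorem inertiaDeg_eq :
    P.inertiaDeg ℤ =
      orderOf (QuotientGroup.mk (ZMod.unitOfCoprime p hpm) : (ZMod 21)ˣ ⧸ Subgroup.zpowers u13) := by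
  rw [inertiaDeg_eq_orderOf_mk 21 L (fixedField L) p hpm P, orderOf_mk_congr (zmodSubgroup_eq L)]

include hpm hP hPp in
/-- `#{𝔭 ∣ p} · ord(p · ⟨13⟩) = 6` in `F`. -/
theorem ncard_primesOver_mul_orderOf :
    ((span {(p : ℤ)}).primesOver (𝓞 (fixedField L))).ncard *
      orderOf (QuotientGroup.mk (ZMod.unitOfCoprime p hpm) : (ZMod 21)ˣ ⧸ Subgroup.zpowers u13) = 6 := by
  rw [← orderOf_mk_congr (zmodSubgroup_eq L), ncard_primesOver_mul_orderOf_mk 21 L (fixedField L) p hpm P,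
    finrank_fixedField]

variable (v : HeightOneSpectrum (𝓞 (maximalRealSubfield (fixedField L)))) [hPv : P.LiesOver v.asIdeal]

include hpm hP hPp hPv in
/-- **THE CENSUS OF `F` AT `p ∤ 21`**: the place `v` of `F⁺` under `P` stays prime in `F` iff `ord(p · ⟨13⟩)` is even
(file 287 on `F`). -/
theorem exists_map_eq_iff :
    (∃ w : HeightOneSpectrum (𝓞 (fixedField L)),
        Ideal.map (algebraMap (𝓞 (maximalRealSubfield (fixedField L))) (𝓞 (fixedField L))) v.asIdeal =
          w.asIdeal) ↔
      Even (orderOf (QuotientGroup.mk (ZMod.unitOfCoprime p hpm) : (ZMod 21)ˣ ⧸ Subgroup.zpowers u13)) := by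
  haveI := isTotallyComplex_fixedField L
  rw [← orderOf_mk_congr (zmodSubgroup_eq L)]
  exact exists_map_eq_iff_even_orderOf_mk 21 L (fixedField L) (finrank_fixedField L) p hpm P v

include hpm hP hPp hPv in
/-- Two primes of `F` above `v` iff `ord(p · ⟨13⟩)` is odd. -/
theorem ncard_primesOver_eq_two_iff :
    (v.asIdeal.primesOver (𝓞 (fixedField L))).ncard = 2 ↔
      Odd (orderOf (QuotientGroup.mk (ZMod.unitOfCoprime p hpm) : (ZMod 21)ˣ ⧸ Subgroup.zpowers u13)) := by
  haveI := isTotallyComplex_fixedField L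
  rw [← orderOf_mk_congr (zmodSubgroup_eq L)]
  exact ncard_primesOver_eq_two_iff_odd_orderOf_mk 21 L (fixedField L) (finrank_fixedField L) p hpm P v

end Census

section Numerals

variable (L : Type*) [Field L] [NumberField L] [IsCyclotomicExtension {21} ℚ L]

/-- **`2` is INERT in `F`**: `f(P/2) = 6`, one prime of `F` above `2`, and the place of `F⁺` under it stays prime. -/
theorem census_two (P : Ideal (𝓞 (fixedField L))) [P.IsPrime] [P.LiesOver (span {(2 : ℤ)})]
    (v : HeightOneSpectrum (𝓞 (maximalRealSubfield (fixedField L)))) [P.LiesOver v.asIdeal] :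
    P.inertiaDeg ℤ = 6 ∧ ((span {(2 : ℤ)}).primesOver (𝓞 (fixedField L))).ncard = 1 ∧
      ∃ w : HeightOneSpectrum (𝓞 (fixedField L)),
        Ideal.map (algebraMap (𝓞 (maximalRealSubfield (fixedField L))) (𝓞 (fixedField L))) v.asIdeal =
          w.asIdeal := by
  have h1 := inertiaDeg_eq L 2 (by decide) P
  have h2 : ((span {(2 : ℤ)}).primesOver (𝓞 (fixedField L))).ncard *
      orderOf (QuotientGroup.mk (ZMod.unitOfCoprime 2 (by decide)) :
        (ZMod 21)ˣ ⧸ Subgroup.zpowers u13) = 6 :=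
    ncard_primesOver_mul_orderOf L 2 (by decide) P
  rw [orderOf_mk_two] at h1 h2
  refine ⟨h1, by omega, ?_⟩
  rw [exists_map_eq_iff L 2 (by decide) P v, orderOf_mk_two]
  decide

/-- **`5` is INERT in `F`**: `f(P/5) = 6`, one prime of `F` above `5`, and the place of `F⁺` under it stays prime. -/
theorem census_five (P : Ideal (𝓞 (fixedField L))) [P.IsPrime] [P.LiesOver (span {(5 : ℤ)})]
    (v : HeightOneSpectrum (𝓞 (maximalRealSubfield (fixedField L)))) [P.LiesOver v.asIdeal] :
    haveI : Fact (Nat.Prime 5) := ⟨by norm_num⟩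
    P.inertiaDeg ℤ = 6 ∧ ((span {(5 : ℤ)}).primesOver (𝓞 (fixedField L))).ncard = 1 ∧
      ∃ w : HeightOneSpectrum (𝓞 (fixedField L)),
        Ideal.map (algebraMap (𝓞 (maximalRealSubfield (fixedField L))) (𝓞 (fixedField L))) v.asIdeal =
          w.asIdeal := by
  haveI : Fact (Nat.Prime 5) := ⟨by norm_num⟩
  have h1 := inertiaDeg_eq L 5 (by decide) P
  have h2 : ((span {(5 : ℤ)}).primesOver (𝓞 (fixedField L))).ncard *
      orderOf (QuotientGroup.mk (ZMod.unitOfCoprime 5 (by decide)) :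
        (ZMod 21)ˣ ⧸ Subgroup.zpowers u13) = 6 :=
    ncard_primesOver_mul_orderOf L 5 (by decide) P
  rw [orderOf_mk_five] at h1 h2
  refine ⟨h1, by omega, ?_⟩
  rw [exists_map_eq_iff L 5 (by decide) P v, orderOf_mk_five]
  decide

/-- **`29` (`≡ 8 mod 21`): `f(P/29) = 2`**, three primes of `F` above `29`, and every place of `F⁺` above `29` STAYS
PRIME in `F` (a degree-one inert place, `N(v) = 29`). -/
theorem census_twentyNine (P : Ideal (𝓞 (fixedField L))) [P.IsPrime] [P.LiesOver (span {(29 : ℤ)})]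
    (v : HeightOneSpectrum (𝓞 (maximalRealSubfield (fixedField L)))) [P.LiesOver v.asIdeal] :
    haveI : Fact (Nat.Prime 29) := ⟨by norm_num⟩
    P.inertiaDeg ℤ = 2 ∧ ((span {(29 : ℤ)}).primesOver (𝓞 (fixedField L))).ncard = 3 ∧
      ∃ w : HeightOneSpectrum (𝓞 (fixedField L)),
        Ideal.map (algebraMap (𝓞 (maximalRealSubfield (fixedField L))) (𝓞 (fixedField L))) v.asIdeal =
          w.asIdeal := by
  haveI : Fact (Nat.Prime 29) := ⟨by norm_num⟩
  have h1 := inertiaDeg_eq L 29 (by decide) P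
  have h2 : ((span {(29 : ℤ)}).primesOver (𝓞 (fixedField L))).ncard *
      orderOf (QuotientGroup.mk (ZMod.unitOfCoprime 29 (by decide)) :
        (ZMod 21)ˣ ⧸ Subgroup.zpowers u13) = 6 :=
    ncard_primesOver_mul_orderOf L 29 (by decide) P
  rw [orderOf_mk_twentyNine] at h1 h2
  refine ⟨h1, by omega, ?_⟩
  rw [exists_map_eq_iff L 29 (by decide) P v, orderOf_mk_twentyNine]
  decide

/-- **`41` (`≡ −1 mod 21`): `f(P/41) = 2`**, three primes of `F` above `41`, every place of `F⁺` above `41` STAYS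
PRIME in `F`. -/
theorem census_fortyOne (P : Ideal (𝓞 (fixedField L))) [P.IsPrime] [P.LiesOver (span {(41 : ℤ)})]
    (v : HeightOneSpectrum (𝓞 (maximalRealSubfield (fixedField L)))) [P.LiesOver v.asIdeal] :
    haveI : Fact (Nat.Prime 41) := ⟨by norm_num⟩
    P.inertiaDeg ℤ = 2 ∧ ((span {(41 : ℤ)}).primesOver (𝓞 (fixedField L))).ncard = 3 ∧
      ∃ w : HeightOneSpectrum (𝓞 (fixedField L)),
        Ideal.map (algebraMap (𝓞 (maximalRealSubfield (fixedField L))) (𝓞 (fixedField L))) v.asIdeal =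
          w.asIdeal := by
  haveI : Fact (Nat.Prime 41) := ⟨by norm_num⟩
  have h1 := inertiaDeg_eq L 41 (by decide) P
  have h2 : ((span {(41 : ℤ)}).primesOver (𝓞 (fixedField L))).ncard *
      orderOf (QuotientGroup.mk (ZMod.unitOfCoprime 41 (by decide)) :
        (ZMod 21)ˣ ⧸ Subgroup.zpowers u13) = 6 :=
    ncard_primesOver_mul_orderOf L 41 (by decide) P
  rw [orderOf_mk_fortyOne] at h1 h2
  refine ⟨h1, by omega, ?_⟩
  rw [exists_map_eq_iff L 41 (by decide) P v, orderOf_mk_fortyOne]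
  decide

/-- **`13` SPLITS COMPLETELY in `F`** (`13 ∈ H_F`): `f(P/13) = 1`, six primes of `F` above `13`, and every place of
`F⁺` above `13` has TWO primes of `F` above it. -/
theorem census_thirteen (P : Ideal (𝓞 (fixedField L))) [P.IsPrime] [P.LiesOver (span {(13 : ℤ)})]
    (v : HeightOneSpectrum (𝓞 (maximalRealSubfield (fixedField L)))) [P.LiesOver v.asIdeal] :
    haveI : Fact (Nat.Prime 13) := ⟨by norm_num⟩
    P.inertiaDeg ℤ = 1 ∧ ((span {(13 : ℤ)}).primesOver (𝓞 (fixedField L))).ncard = 6 ∧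
      (v.asIdeal.primesOver (𝓞 (fixedField L))).ncard = 2 := by
  haveI : Fact (Nat.Prime 13) := ⟨by norm_num⟩
  have h1 := inertiaDeg_eq L 13 (by decide) P
  have h2 : ((span {(13 : ℤ)}).primesOver (𝓞 (fixedField L))).ncard *
      orderOf (QuotientGroup.mk (ZMod.unitOfCoprime 13 (by decide)) :
        (ZMod 21)ˣ ⧸ Subgroup.zpowers u13) = 6 :=
    ncard_primesOver_mul_orderOf L 13 (by decide) P
  rw [orderOf_mk_thirteen] at h1 h2
  refine ⟨h1, by omega, ?_⟩
  rw [ncard_primesOver_eq_two_iff L 13 (by decide) P v, orderOf_mk_thirteen]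
  decide

/-- **`43` (`≡ 1 mod 21`) SPLITS COMPLETELY in `F`**: `f(P/43) = 1`, six primes above `43`, two primes of `F`
above every place of `F⁺` above `43`. -/
theorem census_fortyThree (P : Ideal (𝓞 (fixedField L))) [P.IsPrime] [P.LiesOver (span {(43 : ℤ)})]
    (v : HeightOneSpectrum (𝓞 (maximalRealSubfield (fixedField L)))) [P.LiesOver v.asIdeal] :
    haveI : Fact (Nat.Prime 43) := ⟨by norm_num⟩
    P.inertiaDeg ℤ = 1 ∧ ((span {(43 : ℤ)}).primesOver (𝓞 (fixedField L))).ncard = 6 ∧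
      (v.asIdeal.primesOver (𝓞 (fixedField L))).ncard = 2 := by
  haveI : Fact (Nat.Prime 43) := ⟨by norm_num⟩
  have h1 := inertiaDeg_eq L 43 (by decide) P
  have h2 : ((span {(43 : ℤ)}).primesOver (𝓞 (fixedField L))).ncard *
      orderOf (QuotientGroup.mk (ZMod.unitOfCoprime 43 (by decide)) :
        (ZMod 21)ˣ ⧸ Subgroup.zpowers u13) = 6 :=
    ncard_primesOver_mul_orderOf L 43 (by decide) P
  rw [orderOf_mk_fortyThree] at h1 h2
  refine ⟨h1, by omega, ?_⟩
  rw [ncard_primesOver_eq_two_iff L 43 (by decide) P v, orderOf_mk_fortyThree]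
  decide

/-- **`97` (`≡ 13 mod 21`, of order `2` in `(ℤ/21ℤ)ˣ`) SPLITS COMPLETELY in `F`**: `f(P/97) = 1`, six primes above
`97`, two primes of `F` above every place of `F⁺` above `97` — while `97` has residue degree `2` in `ℚ(ζ₂₁)`. -/
theorem census_ninetySeven (P : Ideal (𝓞 (fixedField L))) [P.IsPrime] [P.LiesOver (span {(97 : ℤ)})]
    (v : HeightOneSpectrum (𝓞 (maximalRealSubfield (fixedField L)))) [P.LiesOver v.asIdeal] :
    haveI : Fact (Nat.Prime 97) := ⟨by norm_num⟩
    P.inertiaDeg ℤ = 1 ∧ ((span {(97 : ℤ)}).primesOver (𝓞 (fixedField L))).ncard = 6 ∧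
      (v.asIdeal.primesOver (𝓞 (fixedField L))).ncard = 2 := by
  haveI : Fact (Nat.Prime 97) := ⟨by norm_num⟩
  have h1 := inertiaDeg_eq L 97 (by decide) P
  have h2 : ((span {(97 : ℤ)}).primesOver (𝓞 (fixedField L))).ncard *
      orderOf (QuotientGroup.mk (ZMod.unitOfCoprime 97 (by decide)) :
        (ZMod 21)ˣ ⧸ Subgroup.zpowers u13) = 6 :=
    ncard_primesOver_mul_orderOf L 97 (by decide) P
  rw [orderOf_mk_ninetySeven] at h1 h2
  refine ⟨h1, by omega, ?_⟩
  rw [ncard_primesOver_eq_two_iff L 97 (by decide) P v, orderOf_mk_ninetySeven]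
  decide

/-- `97` has residue degree `2` in `ℚ(ζ₂₁)` itself (`97 ≡ 13`, `13² ≡ 1 mod 21`): the contrast with `census_ninetySeven`. -/
theorem inertiaDeg_ninetySeven_cyclotomic (Q : Ideal (𝓞 L)) [Q.IsPrime] [Q.LiesOver (span {(97 : ℤ)})] :
    Q.inertiaDeg ℤ = 2 := by
  haveI : Fact (Nat.Prime 97) := ⟨by norm_num⟩
  rw [IsCyclotomicExtension.Rat.inertiaDeg_eq_of_not_dvd (m := 21) 97 L Q (by norm_num)]
  exact orderOf_eq_prime (by decide) (by decide)

end Numerals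

end Summit.Ventures.HodgeRepro2.T5CyclotomicTwentyOneCensus
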